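import Mathlib.Tactic
import HarnessLib
import HarnessLib.Audit.Tags
import Summits.CriticalPhenomena.PercolationContinuityZ3.Theorems.PercNearOneGluingNoHeavyLowerTailSahiAntichainTwoThreeA
import Summits.CriticalPhenomena.PercolationContinuityZ3.Theorems.PercNearOneGluingNoHeavyLowerTailSahiAntichainDaykinRect

/-!
# Antichains, meets plus joins: first steps towards L4 — six members with few labels split 3 + 3 everywhere

Support file (seat `prim-masterthm-p1`, gen 37; `--supports stmt-CriticalPhenomena-4575`).  No `sorry`, no new definitions, standard
axioms.  Memo `run/shared/lean/prim/prim-masterthm/FROM-prim-masterthm-p1-g37-LINEAR-REDUCTION.md` §10 (plan for L4).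

SETTING: V5 ⟸ L4 (`two_mul_card_le_of_L4`, `…TwoThreeA`), where L4 says that a six-member side with at most eleven labels of its own
creates at least four new labels.  The route to L4 is the classification of six-member antichains with `f ≤ 11` (they are the blow-ups of
`C([4],2)`, with `f = 10`).

NEW HERE ([this work], gen 37).
* `card_above_eq_three_of_six_le_eleven`: **in a six-member antichain with `#meets + #joins ≤ 11`, every effective point has exactly three
  members on each side** — `1 + 5` points give `f ≥ 10 + 2` by L3 (`ten_le_of_card_eq_five`) and the one-sided step, `2 + 4` points give
  `f ≥ 12` by `twelve_le_of_two_four` (`…TwoFour`), and dually.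
* `four_le_newLabels_of_cothree_sunflower_three`: at a `3 + 3` point with a CO-sunflower above and a SUNFLOWER below, `newLabels ≥ 4`
  (Daykin on the cross rectangle: `#X · #Y ≥ 9`, one old meet, one old join).  So such points do not occur in a six-member antichain with
  `f ≤ 11` (`4 + 4 + 4 = 12`); the remaining `3 + 3` shapes are listed in memo §10 with their data.
HONEST FRAMING: unconditional lemmas; L4 and V5 remain OPEN. [this work]
-/

namespace Summit.CriticalPhenomena.PercolationContinuityZ3.Theorems.SahiColouredDaykin

open Finset

variable {α : Type*} [DecidableEq α]

/-- **Six members with at most eleven labels split `3 + 3` at every effective point.** [this work] -/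
theorem card_above_eq_three_of_six_le_eleven {P : Finset (Finset α)} {r : α} (hanti : IsAntichain (· ⊆ ·) (P : Set (Finset α)))
    (h6 : #P = 6) (hf : #(meets P) + #(joins P) ≤ 11) (hr : r ∈ effPoints P) :
    #(above P r) = 3 ∧ #(below P r) = 3 := by
  obtain ⟨hA, hB⟩ := mem_effPoints_iff.1 hr
  have hcard := card_above_add_card_below P r
  have hApos : 0 < #(above P r) := card_pos.2 hA
  have hBpos : 0 < #(below P r) := card_pos.2 hB
  have hsplit := card_meets_add_card_joins_split P r
  have hantiA := isAntichain_above hanti r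
  have hantiB := isAntichain_below hanti r
  rw [h6] at hcard
  by_cases hA1 : #(above P r) = 1
  · have h10 := ten_le_of_card_eq_five hantiB (by omega)
    have c2 := two_le_newLabels_of_card_above_eq_one hanti (by omega) hA1
    omega
  by_cases hB1 : #(below P r) = 1
  · have h10 := ten_le_of_card_eq_five hantiA (by omega)
    have c2 := two_le_newLabels_of_card_below_eq_one hanti (by omega) hB1
    omega
  by_cases hA2 : #(above P r) = 2
  · have := twelve_le_of_two_four hanti hA2 (by omega); omega
  by_cases hB2 : #(below P r) = 2
  · have := twelve_le_of_four_two hanti (by omega) hB2; omega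
  · omega

/-- **Co-sunflower above, sunflower below at a `3 + 3` point ⟹ four new labels** (Daykin). [this work] -/
theorem four_le_newLabels_of_cothree_sunflower_three {P : Finset (Finset α)} {r : α} {U K : Finset α}
    (h3 : #(above P r) = 3) (h3' : #(below P r) = 3)
    (hU : ∀ a ∈ above P r, ∀ a' ∈ above P r, a ≠ a' → a ∪ a' = U)
    (hK : ∀ b ∈ below P r, ∀ b' ∈ below P r, b ≠ b' → b ∩ b' = K) : 4 ≤ newLabels P r := by
  have hD := card_above_mul_card_below_le P r
  rw [h3, h3'] at hD
  have hc := card_crossMeets_add_card_crossJoins_le P r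
  have hL := card_meets_le_one_of_sunflower hK
  have hJ := card_joins_le_one_of_cosunflower hU
  have h6 : 6 ≤ #(crossMeets P r) + #(crossJoins P r) := by
    by_contra hlt
    have hx : #(crossMeets P r) ≤ 5 := by omega
    have hy : #(crossJoins P r) ≤ 5 := by omega
    interval_cases (#(crossMeets P r)) <;> interval_cases (#(crossJoins P r)) <;> omega
  omega

/-- Hence an antichain with at most eleven labels has no `3 + 3` point with a co-sunflower above and a sunflower below. [this work] -/
theorem not_cothree_sunflower_three_of_six_le_eleven {P : Finset (Finset α)} {r : α} {U K : Finset α}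
    (hanti : IsAntichain (· ⊆ ·) (P : Set (Finset α))) (hf : #(meets P) + #(joins P) ≤ 11)
    (h3 : #(above P r) = 3) (h3' : #(below P r) = 3)
    (hU : ∀ a ∈ above P r, ∀ a' ∈ above P r, a ≠ a' → a ∪ a' = U)
    (hK : ∀ b ∈ below P r, ∀ b' ∈ below P r, b ≠ b' → b ∩ b' = K) : False := by
  have hsplit := card_meets_add_card_joins_split P r
  have vA := two_mul_card_le_of_card_le_three (above P r) (isAntichain_above hanti r) (by omega)
  have vB := two_mul_card_le_of_card_le_three (below P r) (isAntichain_below hanti r) (by omega)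
  have c4 := four_le_newLabels_of_cothree_sunflower_three h3 h3' hU hK
  omega

end Summit.CriticalPhenomena.PercolationContinuityZ3.Theorems.SahiColouredDaykin
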